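import Mathlib.Algebra.MvPolynomial.CommRing
import Mathlib.Algebra.MvPolynomial.Degrees
import Mathlib.Algebra.MvPolynomial.Equiv
import Mathlib.Algebra.MvPolynomial.NoZeroDivisors
import Mathlib.Algebra.Polynomial.RingDivision
import Mathlib.RingTheory.MvPolynomial.Homogeneous
import Mathlib.RingTheory.Ideal.Span
import Mathlib.Data.Matrix.Basic
import Mathlib.LinearAlgebra.Matrix.Notation
import Mathlib.Algebra.Field.Rat
import Mathlib.Tactic.Ring
import Mathlib.Tactic.FinCases

/-!
# Crux `RankOneTrivialisation` (stmt-ValiantsHypothesis-5667), line `nagata-multilinear-chart` —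
Negative lemmas for stub 3 `stub_degreeBudget_mod_homogeneous_prime`: BOTH remaining hypotheses of
the (landed) degree-budget engine are load-bearing

The landed stub (`Summit.ValiantsHypothesis.Theorems.RankOneTrivialisation.stub_degreeBudget_mod_homogeneous_prime`,
engine `outerProduct_degree_trim`) says: modulo a HOMOGENEOUS PRIME form `f ∈ K[σ]`, an outer-product
factorisation `B ≡ c' w'ᵀ (mod f)` of a square matrix with `deg B_ij ≤ D` can be re-chosen within the
budget `dc + dw ≤ D`.  Here we record, as kernel-checked refutations of the two weakenings, that

* `degreeBudget_false_without_homogeneous`: with `f` PRIME but NOT homogeneous the budget fails —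
  witness `K = ℚ`, `σ = Fin 2`, `f = X 0 - X 1 ^ 2` (prime: `X - C (X₁²)` over the domain `ℚ[X₁]`),
  `B = [[1, X 1], [X 1, X 0]]` (`D = 1`), `B ≡ (1, X 1)ᵀ (1, X 1)` since `X 0 ≡ X 1 ^ 2`; every
  factorisation mod `f` needs `dc ≥ 1` and `dw ≥ 1` (the lift-degree `δ(X₁^k) = ⌈k/2⌉` on
  `ℚ[X₀,X₁]/(f) ≅ ℚ[X₁]` is not additive);
* `degreeBudget_false_without_prime`: with `f` HOMOGENEOUS (nonzero, non-unit, even squarefree) but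
  NOT prime the budget fails — witness `f = X 0 * X 1`, `B = [[1, X 1 + 1], [X 0 + 1, X 0 + X 1 + 1]]`
  (`D = 1`), `B ≡ (1, X 0 + 1)ᵀ (1, X 1 + 1)` since `(X 0 + 1)(X 1 + 1) ≡ X 0 + X 1 + 1`; the top
  components `X 0`, `X 1` of the factors multiply INTO `(f)` with neither in `(f)` — exactly the step
  of `outerProduct_degree_trim` that uses primality.

Common core (`no_budget_one`): if an ideal `I` contains no nonzero polynomial of total degree `≤ 1`
and `B 0 0 = 1`, `B 1 0 = X p + C s`, `B 0 1 = X q + C t`, then `B ≢ c wᵀ (mod I)` whenever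
`dc + dw ≤ 1`: one of `c`, `w` is constant, and eliminating `w 0` (resp. `c 0`) from two congruences
produces a nonzero element of `I` of degree `≤ 1`.

Both refutations are stated inline (no new `def … : Prop`), as in
`Theorems/UlrichPaddedRankOneTrivialisationNegativeLoadBearing.lean`.

(drefute gen 3; complements the mutation record of the line: stub 1 true without `IsDomain`, needs
`det = 0`; stub 2 needs factoriality — `A₂` over the quadric cone; stub 3's bound `D` sharp at `Bpp`.)
-/

noncomputable section

namespace Summit.ValiantsHypothesis.Theorems.RankOneTrivialisation.Negative

open MvPolynomial Matrix

/-! ## Core: no factorisation within budget `1` -/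

section Core

variable {σ K : Type*} [Field K]

/-- Elimination step: from `1 - C a * u ∈ I` and `X r + C s - C b * u ∈ I` one gets the element
`C (b - a * s) - C a * X r ∈ I` of total degree `≤ 1`; if `I` has no nonzero such element then
`a = 0`, whence `1 ∈ I`, impossible. [folklore] -/
theorem elim_false (I : Ideal (MvPolynomial σ K))
    (hI : ∀ g ∈ I, g.totalDegree ≤ 1 → g = 0) (a b s : K) (u : MvPolynomial σ K) (r : σ)
    (h1 : 1 - C a * u ∈ I) (h2 : X r + C s - C b * u ∈ I) : False := by
  have h3 : C b * (1 - C a * u) - C a * (X r + C s - C b * u) ∈ I :=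
    I.sub_mem (I.mul_mem_left _ h1) (I.mul_mem_left _ h2)
  have h4 : C b * (1 - C a * u) - C a * (X r + C s - C b * u)
      = C (b - a * s) - C a * X r := by
    simp only [map_sub, map_mul]
    ring
  rw [h4] at h3
  have hdeg : (C (b - a * s) - C a * X r : MvPolynomial σ K).totalDegree ≤ 1 := by
    refine (totalDegree_sub _ _).trans (max_le ?_ ?_)
    · rw [totalDegree_C]; exact Nat.zero_le _
    · refine (totalDegree_mul _ _).trans ?_
      rw [totalDegree_C, totalDegree_X, zero_add]
  have h0 := hI _ h3 hdeg
  have ha : a = 0 := by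
    have e0 := congr_arg (eval fun _ : σ => (0 : K)) h0
    have e1 := congr_arg (eval fun _ : σ => (1 : K)) h0
    simp only [map_sub, map_mul, eval_C, eval_X, map_zero, mul_zero, sub_zero, mul_one] at e0 e1
    rw [e0, zero_sub, neg_eq_zero] at e1
    exact e1
  subst ha
  have h1' : (1 : MvPolynomial σ K) ∈ I := by
    simpa only [map_zero, zero_mul, sub_zero] using h1
  exact one_ne_zero (hI 1 h1' (by rw [totalDegree_one]; exact Nat.zero_le _))

/-- **Core.** If the ideal `I` contains no nonzero polynomial of total degree `≤ 1`, and the `2 × 2`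
matrix `B` has `B 0 0 = 1`, `B 1 0 = X p + C s`, `B 0 1 = X q + C t`, then `B` has no factorisation
`B ≡ c wᵀ (mod I)` with `deg cᵢ ≤ dc`, `deg wⱼ ≤ dw`, `dc + dw ≤ 1`. [folklore] -/
theorem no_budget_one (I : Ideal (MvPolynomial σ K))
    (hI : ∀ g ∈ I, g.totalDegree ≤ 1 → g = 0)
    (B : Matrix (Fin 2) (Fin 2) (MvPolynomial σ K)) (p q : σ) (s t : K)
    (h00 : B 0 0 = 1) (h10 : B 1 0 = X p + C s) (h01 : B 0 1 = X q + C t)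
    (c w : Fin 2 → MvPolynomial σ K) (dc dw : ℕ) (hsum : dc + dw ≤ 1)
    (hc : ∀ i, (c i).totalDegree ≤ dc) (hw : ∀ j, (w j).totalDegree ≤ dw)
    (h : ∀ i j, B i j - c i * w j ∈ I) : False := by
  rcases Nat.eq_zero_or_pos dc with hdc | hdc
  · -- `c` is constant: eliminate `w 0` from the congruences at `(0,0)` and `(1,0)`
    obtain ⟨a, ha⟩ : ∃ a : Fin 2 → K, ∀ i, c i = C (a i) :=
      ⟨fun i => coeff 0 (c i), fun i =>
        totalDegree_eq_zero_iff_eq_C.1 (Nat.le_zero.1 (hdc ▸ hc i))⟩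
    refine elim_false I hI (a 0) (a 1) s (w 0) p ?_ ?_
    · have := h 0 0
      rwa [h00, ha 0] at this
    · have := h 1 0
      rwa [h10, ha 1] at this
  · -- `w` is constant: eliminate `c 0` from the congruences at `(0,0)` and `(0,1)`
    have hdw : dw = 0 := by omega
    obtain ⟨b, hb⟩ : ∃ b : Fin 2 → K, ∀ j, w j = C (b j) :=
      ⟨fun j => coeff 0 (w j), fun j =>
        totalDegree_eq_zero_iff_eq_C.1 (Nat.le_zero.1 (hdw ▸ hw j))⟩
    refine elim_false I hI (b 0) (b 1) t (c 0) q ?_ ?_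
    · have := h 0 0
      rw [h00, hb 0] at this
      convert this using 1
      ring
    · have := h 0 1
      rw [h01, hb 1] at this
      convert this using 1
      ring

/-- A principal ideal `(f)` with `totalDegree f ≥ 2` contains no nonzero polynomial of total degree
`≤ 1` (`K[σ]` is a domain, degrees add). [folklore] -/
theorem span_no_low_degree {f : MvPolynomial σ K} (hf : 2 ≤ f.totalDegree) :
    ∀ g ∈ Ideal.span {f}, g.totalDegree ≤ 1 → g = 0 := by
  intro g hg hdeg
  obtain ⟨k, rfl⟩ := Ideal.mem_span_singleton'.1 hg
  by_contra hne
  have hk : k ≠ 0 := by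
    rintro rfl
    exact hne (zero_mul _)
  have hf0 : f ≠ 0 := by
    rintro rfl
    exact hne (mul_zero _)
  rw [totalDegree_mul_of_isDomain hk hf0] at hdeg
  omega

end Core

/-! ## Witness 1: `f = X 0 - X 1 ^ 2` (prime, inhomogeneous) -/

section Witness1

/-- `X 0 - X 1 ^ 2 ∈ ℚ[X₀, X₁]` is prime: under `finSuccEquiv` it is `X - C (X₀²)` over the domain
`ℚ[X₀]` (`Polynomial.prime_X_sub_C`). [folklore] -/
theorem prime_X_sub_X_sq : Prime (X 0 - X 1 ^ 2 : MvPolynomial (Fin 2) ℚ) := by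
  have he : finSuccEquiv ℚ 1 (X 0 - X 1 ^ 2) = Polynomial.X - Polynomial.C (X 0 ^ 2) := by
    rw [map_sub, map_pow, finSuccEquiv_X_zero]
    rw [show (1 : Fin 2) = (0 : Fin 1).succ from rfl, finSuccEquiv_X_succ, map_pow]
  have hp : Prime (finSuccEquiv ℚ 1 (X 0 - X 1 ^ 2)) := he ▸ Polynomial.prime_X_sub_C _
  exact (MulEquiv.prime_iff (finSuccEquiv ℚ 1).toMulEquiv).1 hp

/-- `totalDegree (X 0 - X 1 ^ 2) ≥ 2` (the monomial `X 1 ^ 2` occurs). [folklore] -/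
theorem two_le_totalDegree_X_sub_X_sq :
    2 ≤ (X 0 - X 1 ^ 2 : MvPolynomial (Fin 2) ℚ).totalDegree := by
  have hc : coeff (Finsupp.single (1 : Fin 2) 2) (X 0 - X 1 ^ 2 : MvPolynomial (Fin 2) ℚ) = -1 := by
    rw [coeff_sub, coeff_X_pow, if_pos rfl, ← pow_one (X 0 : MvPolynomial (Fin 2) ℚ),
      coeff_X_pow, if_neg]
    · norm_num
    · intro h
      rcases (Finsupp.single_eq_single_iff _ _ _ _).1 h with ⟨-, h2⟩ | ⟨h1, -⟩ <;> omega
  have hs : Finsupp.single (1 : Fin 2) 2 ∈ (X 0 - X 1 ^ 2 : MvPolynomial (Fin 2) ℚ).support := by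
    rw [mem_support_iff, hc]
    norm_num
  have := le_totalDegree hs
  simpa using this

/-- **Stub 3 (`stub_degreeBudget_mod_homogeneous_prime`) is FALSE without HOMOGENEITY of `f`.**
The negated statement is the registered stub with the hypothesis `f.IsHomogeneous e` (and the then
idle binder `e`) deleted, everything else verbatim.  Witness `f = X 0 - X 1 ^ 2` (prime),
`B = [[1, X 1], [X 1, X 0]]`, `D = 1`, `c' = w' = (1, X 1)` (`B ≡ c' w'ᵀ` since `X 0 ≡ X 1 ^ 2`),
and `no_budget_one`. [folklore] -/
theorem degreeBudget_false_without_homogeneous :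
    ¬ ∀ (σ K : Type) [Field K] (f : MvPolynomial σ K), Prime f →
      ∀ (m D : ℕ) (B : Matrix (Fin m) (Fin m) (MvPolynomial σ K)),
        (∀ i j, (B i j).totalDegree ≤ D) →
        ∀ (c' w' : Fin m → MvPolynomial σ K), (∀ i j, B i j - c' i * w' j ∈ Ideal.span {f}) →
          ∃ (c w : Fin m → MvPolynomial σ K) (dc dw : ℕ), dc + dw ≤ D ∧
            (∀ i, (c i).totalDegree ≤ dc) ∧ (∀ i, (w i).totalDegree ≤ dw) ∧
            ∀ i j, B i j - c i * w j ∈ Ideal.span {f} := by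
  intro H
  obtain ⟨B, hB⟩ : ∃ M : Matrix (Fin 2) (Fin 2) (MvPolynomial (Fin 2) ℚ),
      M = !![1, X 1; X 1, X 0] := ⟨_, rfl⟩
  have h00 : B 0 0 = 1 := by rw [hB]; rfl
  have h01 : B 0 1 = X 1 := by rw [hB]; rfl
  have h10 : B 1 0 = X 1 := by rw [hB]; rfl
  have h11 : B 1 1 = X 0 := by rw [hB]; rfl
  have hdeg : ∀ i j, (B i j).totalDegree ≤ 1 := by
    intro i j
    fin_cases i <;> fin_cases j <;>
      simp only [Fin.zero_eta, Fin.mk_one, h00, h01, h10, h11, totalDegree_X, totalDegree_one,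
        zero_le_one, le_refl]
  have hout : ∀ i j, B i j - ![1, X 1] i * ![1, X 1] j
      ∈ Ideal.span {(X 0 - X 1 ^ 2 : MvPolynomial (Fin 2) ℚ)} := by
    intro i j
    fin_cases i <;> fin_cases j <;>
      simp only [Fin.zero_eta, Fin.mk_one, h00, h01, h10, h11, cons_val_zero, cons_val_one,
        Matrix.cons_val_fin_one, mul_one, one_mul, sub_self, Ideal.zero_mem]
    exact Ideal.subset_span (by rw [Set.mem_singleton_iff, sq])
  obtain ⟨c, w, dc, dw, hsum, hc, hw, h⟩ :=
    H (Fin 2) ℚ _ prime_X_sub_X_sq 2 1 B hdeg ![1, X 1] ![1, X 1] hout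
  exact no_budget_one _ (span_no_low_degree two_le_totalDegree_X_sub_X_sq) B 1 1 0 0 h00
    (by rw [h10, map_zero, add_zero]) (by rw [h01, map_zero, add_zero]) c w dc dw hsum hc hw h

end Witness1

/-! ## Witness 2: `f = X 0 * X 1` (homogeneous of degree 2, squarefree, NOT prime) -/

section Witness2

/-- `X 0 * X 1` is a form of degree `2`. [folklore] -/
theorem isHomogeneous_X_mul_X : (X 0 * X 1 : MvPolynomial (Fin 2) ℚ).IsHomogeneous 2 :=
  (isHomogeneous_X ℚ (0 : Fin 2)).mul (isHomogeneous_X ℚ 1)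

/-- `totalDegree (X 0 * X 1) = 2 ≥ 2`. [folklore] -/
theorem two_le_totalDegree_X_mul_X : 2 ≤ (X 0 * X 1 : MvPolynomial (Fin 2) ℚ).totalDegree := by
  have hne : (X 0 * X 1 : MvPolynomial (Fin 2) ℚ) ≠ 0 := mul_ne_zero (X_ne_zero _) (X_ne_zero _)
  rw [isHomogeneous_X_mul_X.totalDegree hne]

/-- **Stub 3 (`stub_degreeBudget_mod_homogeneous_prime`) is FALSE without PRIMALITY of `f`**
(even for a nonzero squarefree form).  The negated statement is the registered stub with the
hypothesis `Prime f` deleted, everything else verbatim.  Witness `f = X 0 * X 1` (homogeneous of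
degree `2`), `B = [[1, X 1 + 1], [X 0 + 1, X 0 + X 1 + 1]]`, `D = 1`, `c' = (1, X 0 + 1)`,
`w' = (1, X 1 + 1)` (`B ≡ c' w'ᵀ` since `(X 0 + 1)(X 1 + 1) ≡ X 0 + X 1 + 1`), and `no_budget_one`.
[folklore] -/
theorem degreeBudget_false_without_prime :
    ¬ ∀ (σ K : Type) [Field K] (f : MvPolynomial σ K) (e : ℕ), f.IsHomogeneous e →
      ∀ (m D : ℕ) (B : Matrix (Fin m) (Fin m) (MvPolynomial σ K)),
        (∀ i j, (B i j).totalDegree ≤ D) →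
        ∀ (c' w' : Fin m → MvPolynomial σ K), (∀ i j, B i j - c' i * w' j ∈ Ideal.span {f}) →
          ∃ (c w : Fin m → MvPolynomial σ K) (dc dw : ℕ), dc + dw ≤ D ∧
            (∀ i, (c i).totalDegree ≤ dc) ∧ (∀ i, (w i).totalDegree ≤ dw) ∧
            ∀ i j, B i j - c i * w j ∈ Ideal.span {f} := by
  intro H
  obtain ⟨B, hB⟩ : ∃ M : Matrix (Fin 2) (Fin 2) (MvPolynomial (Fin 2) ℚ),
      M = !![1, X 1 + C 1; X 0 + C 1, X 0 + X 1 + 1] := ⟨_, rfl⟩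
  have h00 : B 0 0 = 1 := by rw [hB]; rfl
  have h01 : B 0 1 = X 1 + C 1 := by rw [hB]; rfl
  have h10 : B 1 0 = X 0 + C 1 := by rw [hB]; rfl
  have h11 : B 1 1 = X 0 + X 1 + 1 := by rw [hB]; rfl
  have hX1 : ∀ (k : Fin 2) (a : ℚ), (X k + C a : MvPolynomial (Fin 2) ℚ).totalDegree ≤ 1 := by
    intro k a
    refine (totalDegree_add _ _).trans (max_le ?_ ?_)
    · rw [totalDegree_X]
    · rw [totalDegree_C]; exact Nat.zero_le _
  have hdeg : ∀ i j, (B i j).totalDegree ≤ 1 := by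
    intro i j
    fin_cases i <;> fin_cases j <;> simp only [Fin.zero_eta, Fin.mk_one, h00, h01, h10, h11]
    · rw [totalDegree_one]; exact Nat.zero_le _
    · exact hX1 1 1
    · exact hX1 0 1
    · refine (totalDegree_add _ _).trans (max_le ((totalDegree_add _ _).trans (max_le ?_ ?_)) ?_)
      · rw [totalDegree_X]
      · rw [totalDegree_X]
      · rw [totalDegree_one]; exact Nat.zero_le _
  have hout : ∀ i j, B i j - ![1, X 0 + C 1] i * ![1, X 1 + C 1] j
      ∈ Ideal.span {(X 0 * X 1 : MvPolynomial (Fin 2) ℚ)} := by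
    intro i j
    fin_cases i <;> fin_cases j <;>
      simp only [Fin.zero_eta, Fin.mk_one, h00, h01, h10, h11, cons_val_zero, cons_val_one,
        Matrix.cons_val_fin_one, mul_one, one_mul, sub_self, Ideal.zero_mem]
    have : (X 0 + X 1 + 1 - (X 0 + C 1) * (X 1 + C 1) : MvPolynomial (Fin 2) ℚ)
        = -1 * (X 0 * X 1) := by
      rw [map_one]; ring
    rw [this]
    exact Ideal.mul_mem_left _ _ (Ideal.subset_span rfl)
  obtain ⟨c, w, dc, dw, hsum, hc, hw, h⟩ :=
    H (Fin 2) ℚ _ 2 isHomogeneous_X_mul_X 2 1 B hdeg ![1, X 0 + C 1] ![1, X 1 + C 1] hout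
  exact no_budget_one _ (span_no_low_degree two_le_totalDegree_X_mul_X) B 0 1 1 1 h00 h10 h01
    c w dc dw hsum hc hw h

end Witness2

end Summit.ValiantsHypothesis.Theorems.RankOneTrivialisation.Negative

end
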